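import Mathlib
import Summits.CriticalPhenomena.CardyFormulaZ2.Theses.CardyTotalPositivity

/-!
# Line `lattice_split` for the crux `AsymptoticKernelTN` (stmt-CriticalPhenomena-11297)

The strategist's BC2 redirect as a REGISTERED SKELETON: two stubs = the two pieces of the glued split
(both are route items of CardyTotalPositivity, provable / refutable independently) and the kernel-checked
composition `AsymptoticKernelTN_of`, which is the full assembly proof (identical to the stub-free workfile
`Lines/split_assembly.lean`, namespace `…SplitAssembly`; duplicated here under `…LatticeSplit` so that this
file elaborates against the route file alone).

* `stub_halfPlaneKernelTN` — piece X₁ = route item `HalfPlaneKernelTN` (stmt-11300, crux): lattice-exact total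
  nonnegativity of the point first-hit kernel in the half-plane (the load-bearing open stub; its own birth
  skeleton is `Lines/HalfPlaneKernelTN_birth.lean`: tall-box TN + box exhaustion).
* `stub_firstHitDecomposition` — piece X₂ = route item `FirstHitDecomposition` (stmt-18625, support, provable
  now; birth skeleton `Lines/FirstHitDecomposition_birth.lean`).
* `AsymptoticKernelTN_of : HalfPlaneKernelTN → FirstHitDecomposition → AsymptoticKernelTN` — PROVED: at every
  scale the window matrix entries are window sums of the point kernel (X₂); column multilinearity of the
  determinant (`Matrix.detRowAlternating` on the transpose, `MultilinearMap.map_sum_finset`) expands the window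
  determinant into point minors on monotone sources / strictly increasing targets ≥ 1; repeated sources give two
  equal rows (det = 0), otherwise X₁ applies; so every window determinant is ≥ 0 > −ε at every scale.
-/

open scoped BigOperators Matrix
open MeasureTheory Filter

namespace Summit.CriticalPhenomena.CardyFormulaZ2.Cruxes.AsymptoticKernelTN.LatticeSplit

open Literature.Probability.Percolation Literature.Probability.LatticeModels
open Summit.CriticalPhenomena.CardyFormulaZ2.Theses.CardyTotalPositivity

/-! ### Clean names for the objects of the three statements -/

/-- the critical bond measure on `ℤ²` -/
noncomputable abbrev μ : Measure (BondConfig (Site 2)) := bondPercolation (zdGraph 2) half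

/-- the lattice upper half-plane -/
def H : Set (Site 2) := {v : Site 2 | 0 ≤ v 1}

/-- the wired arc `A_s = {(i,0) : i ≤ -s}` (integer parameter) -/
def arc (s : ℤ) : Set (Site 2) := {v | v 1 = 0 ∧ v 0 ≤ -s}

/-- the target segment `{(j,0) : 1 ≤ j ≤ B}` (integer parameter) -/
def seg (B : ℤ) : Set (Site 2) := {v | v 1 = 0 ∧ 1 ≤ v 0 ∧ v 0 ≤ B}

/-- the scaled window distribution function `P_n(σ,x)` of the crux -/
noncomputable def Pn (n : ℕ) (σ x : ℝ) : ℝ := μ.real (openCrossing H (arc ⌊σ * n⌋) (seg ⌊x * n⌋))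

/-- the first-hit event `{X^{(s)} = x}` -/
def hitEv (s x : ℕ) : Set (BondConfig (Site 2)) :=
  openCrossing H (arc s) {![(x : ℤ), 0]} \ openCrossing H (arc s) {v | v 1 = 0 ∧ 1 ≤ v 0 ∧ v 0 < x}

/-- the point first-hit kernel `k(s,x) = P[X^{(s)} = x]` -/
noncomputable def kker (s x : ℕ) : ℝ := μ.real (hitEv s x)

theorem asymptoticKernelTN_iff :
    AsymptoticKernelTN ↔ ∀ (r : ℕ) (σ a b : Fin r → ℝ), StrictMono σ → (∀ i, 0 < σ i) →
      (∀ j, 0 ≤ a j ∧ a j < b j) → (∀ j k, j < k → b j ≤ a k) → ∀ ε : ℝ, 0 < ε →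
      ∀ᶠ n : ℕ in Filter.atTop, -ε ≤ (Matrix.of fun i j ↦ Pn n (σ i) (b j) - Pn n (σ i) (a j)).det :=
  Iff.rfl

theorem halfPlaneKernelTN_iff :
    HalfPlaneKernelTN ↔ ∀ (r : ℕ) (s x : Fin r → ℕ), StrictMono s → StrictMono x → (∀ j, 1 ≤ x j) →
      0 ≤ (Matrix.of fun i j ↦ kker (s i) (x j)).det :=
  Iff.rfl

theorem firstHitDecomposition_iff :
    FirstHitDecomposition ↔ ∀ (s A B : ℕ), A ≤ B →
      μ.real (openCrossing H (arc s) (seg B)) - μ.real (openCrossing H (arc s) (seg A)) =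
        ∑ x ∈ Finset.Ioc A B, kker s x :=
  Iff.rfl

/-! ### Linear algebra: column-multilinear expansion of a window determinant -/

/-- Column-multilinear expansion: the determinant of the matrix whose `j`-th column is the sum
over the window `W j` of the point columns is the sum over all choices `p ∈ Π_j W j` of the point
determinants. -/
theorem det_window_expand {r : ℕ} (k : ℕ → ℕ → ℝ) (s : Fin r → ℕ) (W : Fin r → Finset ℕ) :
    (Matrix.of fun i j ↦ ∑ x ∈ W j, k (s i) x).det =
      ∑ p ∈ Fintype.piFinset W, (Matrix.of fun i j ↦ k (s i) (p j)).det := by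
  classical
  -- pass to the transpose, whose rows are the window sums
  have hT : (Matrix.of fun i j ↦ ∑ x ∈ W j, k (s i) x) =
      (Matrix.of fun j i ↦ ∑ x ∈ W j, k (s i) x)ᵀ := by
    ext i j; simp
  rw [hT, Matrix.det_transpose]
  have hrow : (Matrix.of fun j i ↦ ∑ x ∈ W j, k (s i) x) =
      (fun j ↦ ∑ x ∈ W j, (fun i ↦ k (s i) x) : Fin r → Fin r → ℝ) := by
    ext j i; simp [Finset.sum_apply]
  have key := MultilinearMap.map_sum_finset
    (Matrix.detRowAlternating : ((Fin r → ℝ) [⋀^Fin r]→ₗ[ℝ] ℝ)).toMultilinearMap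
    (fun (j : Fin r) (x : ℕ) ↦ (fun i ↦ k (s i) x : Fin r → ℝ)) W
  simp only [AlternatingMap.coe_multilinearMap] at key
  have h1 : (Matrix.of fun j i ↦ ∑ x ∈ W j, k (s i) x).det =
      Matrix.detRowAlternating (fun j ↦ ∑ x ∈ W j, (fun i ↦ k (s i) x) : Fin r → Fin r → ℝ) := by
    rw [hrow]; rfl
  rw [h1, key]
  refine Finset.sum_congr rfl fun p _ ↦ ?_
  have h2 : (Matrix.of fun i j ↦ k (s i) (p j)) = (Matrix.of fun j i ↦ k (s i) (p j))ᵀ := by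
    ext i j; simp
  rw [h2, Matrix.det_transpose]
  rfl

/-- If the point kernel is totally nonnegative on strictly increasing index tuples with targets
`≥ 1`, then every window determinant with monotone sources and ordered windows of targets `≥ 1`
is nonnegative. -/
theorem det_window_nonneg {r : ℕ} (k : ℕ → ℕ → ℝ) (s : Fin r → ℕ) (W : Fin r → Finset ℕ)
    (hs : Monotone s)
    (hW : ∀ j j', j < j' → ∀ x ∈ W j, ∀ y ∈ W j', x < y)
    (hW1 : ∀ j, ∀ x ∈ W j, 1 ≤ x)
    (hTN : ∀ (s x : Fin r → ℕ), StrictMono s → StrictMono x → (∀ j, 1 ≤ x j) →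
      0 ≤ (Matrix.of fun i j ↦ k (s i) (x j)).det) :
    0 ≤ (Matrix.of fun i j ↦ ∑ x ∈ W j, k (s i) x).det := by
  classical
  rw [det_window_expand]
  refine Finset.sum_nonneg fun p hp ↦ ?_
  have hpmem : ∀ j, p j ∈ W j := fun j ↦ Fintype.mem_piFinset.mp hp j
  have hpx : StrictMono p := fun j j' hjj' ↦ hW j j' hjj' _ (hpmem j) _ (hpmem j')
  have hp1 : ∀ j, 1 ≤ p j := fun j ↦ hW1 j _ (hpmem j)
  by_cases hinj : Function.Injective s
  · exact hTN s p (hs.strictMono_of_injective hinj) hpx hp1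
  · simp only [Function.Injective, not_forall] at hinj
    obtain ⟨i, i', hsi, hne⟩ := hinj
    rw [Matrix.det_zero_of_row_eq hne]
    ext j
    simp [hsi]

/-! ### The assembly -/

/-- Glued split of the crux: `HalfPlaneKernelTN → FirstHitDecomposition → AsymptoticKernelTN`.
For every scale `n` the window matrix is, entrywise, a sum of point-kernel columns over ordered
lattice windows (first-hit decomposition); by column multilinearity its determinant is a sum of
point-kernel minors with monotone sources and strictly increasing targets, each `≥ 0` (repeated
sources give two equal rows). Hence every window determinant is `≥ 0 > -ε` at every scale. -/
theorem asymptoticKernelTN_of_subs (hTN : HalfPlaneKernelTN) (hdec : FirstHitDecomposition) :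
    AsymptoticKernelTN := by
  rw [asymptoticKernelTN_iff]
  rw [halfPlaneKernelTN_iff] at hTN
  rw [firstHitDecomposition_iff] at hdec
  intro r σ a b hσ hσpos hab hba ε hε
  refine Filter.Eventually.of_forall fun n ↦ ?_
  suffices h : 0 ≤ (Matrix.of fun i j ↦ Pn n (σ i) (b j) - Pn n (σ i) (a j)).det by linarith
  -- integer data at scale `n`
  set s : Fin r → ℕ := fun i ↦ ⌊σ i * n⌋.toNat with hs_def
  set A : Fin r → ℕ := fun j ↦ ⌊a j * n⌋.toNat with hA_def
  set B : Fin r → ℕ := fun j ↦ ⌊b j * n⌋.toNat with hB_def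
  have hσfl : ∀ i, (0 : ℤ) ≤ ⌊σ i * n⌋ := fun i ↦
    Int.floor_nonneg.mpr (mul_nonneg (le_of_lt (hσpos i)) (Nat.cast_nonneg n))
  have hafl : ∀ j, (0 : ℤ) ≤ ⌊a j * n⌋ := fun j ↦
    Int.floor_nonneg.mpr (mul_nonneg (hab j).1 (Nat.cast_nonneg n))
  have hbfl : ∀ j, (0 : ℤ) ≤ ⌊b j * n⌋ := fun j ↦
    Int.floor_nonneg.mpr (mul_nonneg (le_of_lt (lt_of_le_of_lt (hab j).1 (hab j).2))
      (Nat.cast_nonneg n))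
  have hs_cast : ∀ i, ((s i : ℕ) : ℤ) = ⌊σ i * n⌋ := fun i ↦ Int.toNat_of_nonneg (hσfl i)
  have hA_cast : ∀ j, ((A j : ℕ) : ℤ) = ⌊a j * n⌋ := fun j ↦ Int.toNat_of_nonneg (hafl j)
  have hB_cast : ∀ j, ((B j : ℕ) : ℤ) = ⌊b j * n⌋ := fun j ↦ Int.toNat_of_nonneg (hbfl j)
  -- ordering data
  have hs_mono : Monotone s := by
    intro i i' hii'
    simp only [hs_def]
    exact Int.toNat_le_toNat (Int.floor_mono (mul_le_mul_of_nonneg_right (hσ.monotone hii')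
      (Nat.cast_nonneg n)))
  have hAB : ∀ j, A j ≤ B j := by
    intro j
    simp only [hA_def, hB_def]
    exact Int.toNat_le_toNat (Int.floor_mono (mul_le_mul_of_nonneg_right (le_of_lt (hab j).2)
      (Nat.cast_nonneg n)))
  have hBA : ∀ j j', j < j' → B j ≤ A j' := by
    intro j j' hjj'
    simp only [hA_def, hB_def]
    exact Int.toNat_le_toNat (Int.floor_mono (mul_le_mul_of_nonneg_right (hba j j' hjj')
      (Nat.cast_nonneg n)))
  -- entries = window sums of the point kernel (first-hit decomposition)
  have hentry : ∀ i j, Pn n (σ i) (b j) - Pn n (σ i) (a j) =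
      ∑ x ∈ Finset.Ioc (A j) (B j), kker (s i) x := by
    intro i j
    have h := hdec (s i) (A j) (B j) (hAB j)
    rw [hs_cast i, hA_cast j, hB_cast j] at h
    simpa [Pn] using h
  have hM : (Matrix.of fun i j ↦ Pn n (σ i) (b j) - Pn n (σ i) (a j)) =
      Matrix.of fun i j ↦ ∑ x ∈ Finset.Ioc (A j) (B j), kker (s i) x := by
    ext i j; simp only [Matrix.of_apply]; exact hentry i j
  rw [hM]
  refine det_window_nonneg kker s (fun j ↦ Finset.Ioc (A j) (B j)) hs_mono ?_ ?_ ?_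
  · intro j j' hjj' x hx y hy
    have hx' := (Finset.mem_Ioc.mp hx).2
    have hy' := (Finset.mem_Ioc.mp hy).1
    exact lt_of_le_of_lt (le_trans hx' (hBA j j' hjj')) hy'
  · intro j x hx
    have := (Finset.mem_Ioc.mp hx).1
    omega
  · intro s' x hs' hx hx1
    exact hTN r s' x hs' hx hx1

/-! ### Registered stubs and the composition -/

/-- stub 1 (load-bearing, open): piece X₁ — lattice-exact TN of the half-plane point first-hit kernel
(= route item `HalfPlaneKernelTN`, stmt-CriticalPhenomena-11300). -/
theorem stub_halfPlaneKernelTN : HalfPlaneKernelTN := by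
  sorry

/-- stub 2 (provable now): piece X₂ — first-hit decomposition of the window probabilities
(= route item `FirstHitDecomposition`, stmt-CriticalPhenomena-18625). -/
theorem stub_firstHitDecomposition : FirstHitDecomposition := by
  sorry

/-- composition (kernel-checked, no sorry of its own): the two pieces give the crux BY NAME. -/
theorem AsymptoticKernelTN_of : HalfPlaneKernelTN → FirstHitDecomposition → AsymptoticKernelTN :=
  fun h1 h2 ↦ asymptoticKernelTN_of_subs h1 h2

end Summit.CriticalPhenomena.CardyFormulaZ2.Cruxes.AsymptoticKernelTN.LatticeSplit
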